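import Summits.ResolutionOfSingularities.ResolutionOfSingularities.Theorems.DescentMapKernels
import Summits.ResolutionOfSingularities.ResolutionOfSingularities.Theorems.CouplingCutClasses
import Summits.ResolutionOfSingularities.ResolutionOfSingularities.Theorems.CouplingCutCoupled
import HarnessLib

/-! # CouplingMapKernels — decomp-res-lens-4 g40 second node «CouplingMap», FILE C (§136–§138a: the companion chain of a coupled sheaf;
no near-branch, isolation and the coupling descent; THE PORT `CouplingPort n` IS A THEOREM `couplingPort_holds`, `couplingPortAll_holds`).
Cone-free (no Theses import).  VERBATIM slice of HOME/decomp-res-lens-4/g40/CouplingMap.lean (module docstring there).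

THE MAP.  Along an in-locus principal IMPURE shadow with COMMENSURABLE factor orders (`ν₀ ∣ μ ∨ μ ∣ ν₀`, `μ = n − ν₀ ≥ 1`; g40 cofactor
datum `exists_factorAt_cofactor`, constancy `topOrder_eq_of_factorAt`), the g36 companion chain of the COUPLED sheaf `G^{a′} ⊔ K^{b′}`
(balanced `a′ν₀ = b′μ = w = max(ν₀, μ)`) is g18's coupled marking of the two factor chains at every stage (`transform_coupled`, divisibility
at the point centres from Hironaka2017 `le_vanishingIdeal_pow_of_forall_le_idealOrder`, orders from g33 `FactorAt.forcing`); a near-branch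
of it would be a near-branch of BOTH factor chains (Literature `Ideal.pow_le_pow_mul_iff` on the regular stalk), hence — generizing the
forced factorization (`stalkIdeal_map_stalkSpecializes`) and super-adding orders (g40 `add_idealOrder_le_idealOrder_mul`) — a proper
generization of the marked point inside `Sing(I, n)`, contradicting `T.isolated`; so g38 `isIsolatedIn_of_brSet_eq_empty` feeds g36
`towerOfCompanion`/`companionTower` (+ `_isBase/_isDatum/_boundary` BY NAME): a forced tower of weight `w`, `1 ≤ w < n`, over the same
field.  (Sources: Kollar2007 3.58–3.60, 3.71; BierstoneGrigorievMilmanWlodarczyk2011 §3.1–3.2, Lemma 3.2.1; EncinasVillamayor2000;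
CossartJannsenSaito2020 §4, §6; Hironaka1964 Ch. III; Matsumura1987 Thm. 14.2, 16.2; StacksProject 01J7.) -/

set_option linter.dupNamespace false
set_option linter.unusedSectionVars false

noncomputable section

open CategoryTheory AlgebraicGeometry IsLocalRing TopologicalSpace
open Literature.AlgebraicGeometry.Resolution
open Summit.ResolutionOfSingularities.ResolutionOfSingularities.Theorems
open WeakOrderReduction ForcedTowerClasses DivergentTowerClasses MonomialTowerClasses
open HugDimensionClasses HugDimensionKernels SurfaceShadowClasses SurfaceShadowKernels
open NearPointCut (SingularClass)
open Scheme.IdealSheafData (vanishingIdeal)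
open Literature.AlgebraicGeometry.Resolution.Hironaka2005 (le_idealOrder_of_mul_le le_idealOrder_of_mul_le')

universe u

namespace Summit.ResolutionOfSingularities.ResolutionOfSingularities.Theorems.HugValuationCut

open MarkedIdealCoupling


section CoupledChain

/-! ## §136 (g40 · NEW · KERNEL) THE COMPANION CHAIN OF A COUPLED SHEAF

For a stalk-local factorization `FactorAt T m a b G K` and balanced exponents `a′ a = b′ b`, the g36 companion chain of the COUPLED
sheaf `G^{a′} ⊔ K^{b′}` with weight `a′ a` is, at every stage, g18's coupled marking of the two companion chains of `G` and `K`: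
the transform law `transform_coupled` (PROVED in g18) applies at each point blow-up because both chains keep their orders `a`, `b`
at the marked points (g33 forcing), which is the divisibility `σ^* G_j ⊆ σ^* 𝔪^{a}`, `σ^* K_j ⊆ σ^* 𝔪^{b}` (Hironaka2017). -/

variable {k : Type} [Field k]

/-- the order is antitone in the ideal sheaf. [folklore] -/
private theorem idealOrder_le_of_le {Y : Scheme.{u}} {I J : Y.IdealSheafData} (h : I ≤ J) (y : Y) :
    idealOrder J y ≤ idealOrder I y := by
  refine ENat.forall_natCast_le_iff_le.mp fun c hc => ?_
  rw [le_idealOrder_iff] at hc ⊢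
  exact (stalkIdeal_mono h y).trans hc

/-- **DIVISIBILITY AT A POINT CENTRE**: if `ord_{x_i} J ≥ μ` then `π_i^* J ⊆ (π_i^* 𝓘(x_i))^μ` — the pull-back of `J` is divisible by
the `μ`-th power of the exceptional ideal of the blow-up of the marked point. (Sources: Hironaka1964, Ch. III; BierstoneGrigorievMilmanWlodarczyk2011,
Lemma 3.2.1; Matsumura1987, Thm. 16.2.) -/
theorem comap_le_comap_centre_pow (T : ForcedTower) (g : T.St 0 ⟶ Spec (.of k)) (hB : IsBase (T.St 0) g) (i : ℕ)
    {J : (T.St i).IdealSheafData} {μ : ℕ} (hJ : ((μ : ℕ) : ℕ∞) ≤ idealOrder J (T.pt i)) :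
    J.comap (T.π i) ≤ (T.centre i).comap (T.π i) ^ μ := by
  obtain ⟨hN, hR⟩ := tower_isLocallyNoetherian_isRegular T g hB i
  haveI := hN
  have hreg : Scheme.IsRegular (vanishingIdeal ⟨{T.pt i}, T.isClosed_pt i⟩).subscheme := by
    rw [← tower_centre_eq_vanishingIdeal T i]
    exact T.centre_regular i
  have hY : ∀ y ∈ ((⟨{T.pt i}, T.isClosed_pt i⟩ : Closeds (T.St i)) : Set (T.St i)), ((μ : ℕ) : ℕ∞) ≤ idealOrder J y := by
    intro y hy
    have hy' : y = T.pt i := by simpa using hy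
    rw [hy']
    exact hJ
  rw [tower_centre_eq_vanishingIdeal T i]
  exact comap_le_comap_pow_of_le_pow
    (Literature.AlgebraicGeometry.Hironaka2017.le_vanishingIdeal_pow_of_forall_le_idealOrder hR hreg hY) (T.π i)

/-- **THE COMPANION CHAIN OF THE COUPLED SHEAF IS THE COUPLED MARKING OF THE TWO COMPANION CHAINS** (induction on g18
`transform_coupled`; divisibility by `comap_le_comap_centre_pow`, orders by g33 `FactorAt.forcing`).
(Sources: BierstoneGrigorievMilmanWlodarczyk2011, §3.2; Kollar2007, 3.58–3.60; EncinasVillamayor2000.) -/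
theorem companionMarked_coupled (T : ForcedTower) (g : T.St 0 ⟶ Spec (.of k)) (hB : IsBase (T.St 0) g) {n : ℕ}
    (hD : IsDatum n (T.D 0)) {m a b : ℕ} {G K : (T.St m).IdealSheafData} (hF : FactorAt T m a b G K) {a' b' : ℕ}
    (hbal : a' * a = b' * b) :
    ∀ j, companionMarked T m (a' * a) (G ^ a' ⊔ K ^ b') j =
      coupled (companionMarked T m a G j) (companionMarked T m b K j) a' b'
  | 0 => rfl
  | j + 1 => by
    obtain ⟨hN1, -⟩ := tower_isLocallyNoetherian_isRegular T g hB (m + j + 1)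
    haveI := hN1
    rw [companionMarked_succ, companionMarked_coupled T g hB hD hF hbal j, companionMarked_succ, companionMarked_succ]
    refine transform_coupled (T.isBlowup (m + j)).isEffectiveCartier _ _ ?_ ?_ ?_
    · rw [companionMarked_mult, companionMarked_mult, hbal]
    · rw [companionMarked_ideal, companionMarked_mult]
      exact comap_le_comap_centre_pow T g hB (m + j) (hF.forcing T g hB hD j).2.1.ge
    · rw [companionMarked_ideal, companionMarked_mult]
      exact comap_le_comap_centre_pow T g hB (m + j) (hF.forcing T g hB hD j).2.2.ge

/-- **the ideal of the coupled chain**: `facIter T m (a′a) (G^{a′} ⊔ K^{b′}) j = G_j^{a′} ⊔ K_j^{b′}`. [folklore] -/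
theorem facIter_coupled (T : ForcedTower) (g : T.St 0 ⟶ Spec (.of k)) (hB : IsBase (T.St 0) g) {n : ℕ}
    (hD : IsDatum n (T.D 0)) {m a b : ℕ} {G K : (T.St m).IdealSheafData} (hF : FactorAt T m a b G K) {a' b' : ℕ}
    (hbal : a' * a = b' * b) (j : ℕ) :
    facIter T m (a' * a) (G ^ a' ⊔ K ^ b') j = facIter T m a G j ^ a' ⊔ facIter T m b K j ^ b' := by
  rw [← companionMarked_ideal, companionMarked_coupled T g hB hD hF hbal j, coupled_ideal, companionMarked_ideal,
    companionMarked_ideal]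

end CoupledChain

section CouplingDescent

/-! ## §137 (g40 · NEW · KERNEL) NO NEAR-BRANCH, ISOLATION, AND THE COUPLING DESCENT

A near-branch of the coupled chain is a near-branch of BOTH factor chains (the order is a valuation on the regular stalk at the
generization), hence — generizing the forced factorization `I = G_j K_j` and super-adding orders — a proper generization of the marked
point inside `Sing(I_{m+j}, n)`, which `T.isolated` forbids.  So the coupled chain isolates the marked points (g38) and g36's
restricted re-rooted companion tower of the coupled sheaf is a forced tower over the same field, of weight `w = a′ν₀ = b′μ`. -/

variable {k : Type} [Field k]

/-- **THE COUPLED CHAIN HAS NO NEAR-BRANCH** at any stage (no isolation hypothesis on the shadow).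
(Sources: StacksProject, Tag 01J7; Matsumura1987, Thm. 14.2; Kollar2007, 3.58–3.60; BierstoneGrigorievMilmanWlodarczyk2011, §3.2.) -/
theorem HugShadow.brSet_coupled_eq_empty (T : ForcedTower) (g : T.St 0 ⟶ Spec (.of k)) (hB : IsBase (T.St 0) g) {n : ℕ}
    (hD : IsDatum n (T.D 0)) (S : HugShadow T) {a b : ℕ} {K : (T.St S.m).IdealSheafData} (hF : FactorAt T S.m a b S.germ K)
    {a' b' : ℕ} (ha' : 0 < a') (hb' : 0 < b') (hbal : a' * a = b' * b) (j : ℕ) :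
    brSet T (S.m + j) (a' * a) (facIter T S.m (a' * a) (S.germ ^ a' ⊔ K ^ b') j) = ∅ := by
  refine Set.eq_empty_iff_forall_notMem.mpr fun η hη => ?_
  obtain ⟨hηx, hne, hηw⟩ := hη
  obtain ⟨hN, hR⟩ := tower_isLocallyNoetherian_isRegular T g hB (S.m + j)
  haveI := hN
  haveI : IsRegularLocalRing ((T.St (S.m + j)).presheaf.stalk η) := hR η
  have hab : a + b = n := hF.add_eq T g hB hD
  rw [facIter_coupled T g hB hD hF hbal j, le_idealOrder_iff, stalkIdeal_sup, stalkIdeal_pow, stalkIdeal_pow,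
    sup_le_iff, Ideal.pow_le_pow_mul_iff ha', hbal, Ideal.pow_le_pow_mul_iff hb'] at hηw
  obtain ⟨hG, hK⟩ := hηw
  -- generize the forced factorization `I_x = G_{j,x} · K_{j,x}` to `η`
  have hIη : stalkIdeal (T.D (S.m + j)).ideal η = stalkIdeal (facIter T S.m a S.germ j * facIter T S.m b K j) η := by
    rw [stalkIdeal_mul, ← stalkIdeal_map_stalkSpecializes (T.D (S.m + j)).ideal hηx, (hF.forcing T g hB hD j).1,
      Ideal.map_mul, stalkIdeal_map_stalkSpecializes, stalkIdeal_map_stalkSpecializes]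
  have hordI : ((n : ℕ) : ℕ∞) ≤ idealOrder (T.D (S.m + j)).ideal η := by
    rw [idealOrder_congr_stalk hIη, ← hab, Nat.cast_add]
    calc ((a : ℕ) : ℕ∞) + ((b : ℕ) : ℕ∞)
        ≤ idealOrder (facIter T S.m a S.germ j) η + idealOrder (facIter T S.m b K j) η :=
          add_le_add ((le_idealOrder_iff _ _ _).mpr hG) ((le_idealOrder_iff _ _ _).mpr hK)
      _ ≤ idealOrder (facIter T S.m a S.germ j * facIter T S.m b K j) η := add_idealOrder_le_idealOrder_mul _ _ η
  have hmem : η ∈ ((T.D (S.m + j)).support : Set (T.St (S.m + j))) := by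
    rw [MarkedIdeal.mem_support_iff, tower_mult_eq T hD (S.m + j)]
    exact (le_idealOrder_iff _ _ _).mp hordI
  obtain ⟨-, U, hxU, hU⟩ := T.isolated (S.m + j)
  exact hne (hU ⟨hηx.mem_open U.isOpen hxU, hmem⟩)

/-- **THE COUPLED CHAIN ISOLATES THE MARKED POINTS** in its weight-`a′a` locus, at every stage (g38 `isIsolatedIn_of_brSet_eq_empty`).
(Sources: Kollar2007, 3.58–3.60; BierstoneGrigorievMilmanWlodarczyk2011, §3.1–3.2.) -/
theorem HugShadow.isIsolatedIn_coupled (T : ForcedTower) (g : T.St 0 ⟶ Spec (.of k)) (hB : IsBase (T.St 0) g) {n : ℕ}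
    (hD : IsDatum n (T.D 0)) (S : HugShadow T) {a b : ℕ} {K : (T.St S.m).IdealSheafData} (hF : FactorAt T S.m a b S.germ K)
    {a' b' : ℕ} (ha' : 0 < a') (hb' : 0 < b') (hbal : a' * a = b' * b) (j : ℕ) :
    IsIsolatedIn ((companionMarked T S.m (a' * a) (S.germ ^ a' ⊔ K ^ b') j).support : Set (T.St (S.m + j)))
      (T.pt (S.m + j)) := by
  obtain ⟨hN, hR⟩ := tower_isLocallyNoetherian_isRegular T g hB (S.m + j)
  haveI := hN
  haveI : IsRegularLocalRing ((T.St (S.m + j)).presheaf.stalk (T.pt (S.m + j))) := hR _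
  have hS : ((companionMarked T S.m (a' * a) (S.germ ^ a' ⊔ K ^ b') j).support : Set (T.St (S.m + j))) =
      {y | ((a' * a : ℕ) : ℕ∞) ≤ idealOrder (facIter T S.m (a' * a) (S.germ ^ a' ⊔ K ^ b') j) y} :=
    Set.ext fun y => mem_support_companionMarked_iff T S.m (a' * a) _ j y
  rw [hS]
  refine isIsolatedIn_of_brSet_eq_empty T g hB (S.m + j) (a' * a) _ ?_ (S.brSet_coupled_eq_empty T g hB hD hF ha' hb' hbal j)
  rw [facIter_coupled T g hB hD hF hbal j, le_idealOrder_iff, stalkIdeal_sup, stalkIdeal_pow, stalkIdeal_pow, sup_le_iff,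
    Ideal.pow_le_pow_mul_iff ha', hbal, Ideal.pow_le_pow_mul_iff hb']
  exact ⟨(le_idealOrder_iff _ _ _).mp (hF.forcing T g hB hD j).2.1.ge, (le_idealOrder_iff _ _ _).mp (hF.forcing T g hB hD j).2.2.ge⟩

/-- **THE COUPLING DESCENT**: a stalk-local factorization of the shadow's germ with BOTH weights positive and COMMENSURABLE (`a ∣ b`
or `b ∣ a`) roots — via the coupled sheaf `G^{a′} ⊔ K^{b′}` with `(a′, b′) = (b/a, 1)` or `(1, a/b)` and g36's restricted re-rooted
`companionTower` — a forced tower over the same field of weight `w = max(a, b)`, `1 ≤ w < n = a + b`.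
(Sources: BierstoneGrigorievMilmanWlodarczyk2011, §3.1–3.2; Kollar2007, 3.58–3.60, 3.71; EncinasVillamayor2000; CossartJannsenSaito2020, §6.) -/
theorem HugShadow.couplingDescent (T : ForcedTower) (g : T.St 0 ⟶ Spec (.of k)) (hB : IsBase (T.St 0) g) {n : ℕ}
    (hD : IsDatum n (T.D 0)) (S : HugShadow T) {a b : ℕ} {K : (T.St S.m).IdealSheafData} (hF : FactorAt T S.m a b S.germ K)
    (ha : 1 ≤ a) (hb : 1 ≤ b) (hdiv : a ∣ b ∨ b ∣ a) :
    ∃ n' : ℕ, 1 ≤ n' ∧ n' < n ∧ ∃ (T' : ForcedTower) (g' : T'.St 0 ⟶ Spec (.of k)),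
      IsBase (T'.St 0) g' ∧ IsDatum n' (T'.D 0) ∧ (T'.D 0).boundary = [] := by
  have hab : a + b = n := hF.add_eq T g hB hD
  -- balanced exponents, one of them equal to `1`
  obtain ⟨a', b', ha', hb', hbal, hone⟩ :
      ∃ a' b' : ℕ, 0 < a' ∧ 0 < b' ∧ a' * a = b' * b ∧ (a' = 1 ∨ b' = 1) := by
    rcases hdiv with ⟨c, hc⟩ | ⟨c, hc⟩
    · refine ⟨c, 1, Nat.pos_of_ne_zero ?_, one_pos, by rw [hc, one_mul, mul_comm], Or.inr rfl⟩
      rintro rfl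
      rw [mul_zero] at hc
      omega
    · refine ⟨1, c, one_pos, Nat.pos_of_ne_zero ?_, by rw [hc, one_mul, mul_comm], Or.inl rfl⟩
      rintro rfl
      rw [mul_zero] at hc
      omega
  have hI := S.isIsolatedIn_coupled T g hB hD hF ha' hb' hbal
  -- the weight `w = a′ a` is `a` or `b`
  have hw : a' * a = a ∨ a' * a = b := by
    rcases hone with h1 | h1
    · exact Or.inl (by rw [h1, one_mul])
    · exact Or.inr (by rw [hbal, h1, one_mul])
  -- root open: the exponent-`1` summand bounds the order of the coupled sheaf at the marked point by `w`
  have hord : idealOrder (S.germ ^ a' ⊔ K ^ b') (T.pt S.m) ≤ ((a' * a : ℕ) : ℕ∞) := by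
    rcases hone with h1 | h1
    · have hle : S.germ ≤ S.germ ^ a' ⊔ K ^ b' := by
        rw [h1, pow_one]
        exact le_sup_left
      calc idealOrder (S.germ ^ a' ⊔ K ^ b') (T.pt S.m) ≤ idealOrder S.germ (T.pt S.m) := idealOrder_le_of_le hle _
        _ = ((a : ℕ) : ℕ∞) := hF.2.1
        _ = ((a' * a : ℕ) : ℕ∞) := by rw [h1, one_mul]
    · have hle : K ≤ S.germ ^ a' ⊔ K ^ b' := by
        rw [h1, pow_one]
        exact le_sup_right
      calc idealOrder (S.germ ^ a' ⊔ K ^ b') (T.pt S.m) ≤ idealOrder K (T.pt S.m) := idealOrder_le_of_le hle _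
        _ = ((b : ℕ) : ℕ∞) := hF.2.2
        _ = ((a' * a : ℕ) : ℕ∞) := by rw [hbal, h1, one_mul]
  have h0 : (towerOfCompanion T S.m (a' * a) (S.germ ^ a' ⊔ K ^ b') hI).pt 0 ∈
      companionRootOpens T S.m (a' * a) (S.germ ^ a' ⊔ K ^ b') hI g hB :=
    (mem_companionRootOpens_iff T S.m (a' * a) (S.germ ^ a' ⊔ K ^ b') hI g hB (T.pt S.m)).mpr hord
  refine ⟨a' * a, ?_, ?_, companionTower T S.m (a' * a) (S.germ ^ a' ⊔ K ^ b') hI g hB h0,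
    (companionRootOpens T S.m (a' * a) (S.germ ^ a' ⊔ K ^ b') hI g hB).ι ≫ toRoot T S.m ≫ g,
    companionTower_isBase T S.m (a' * a) _ hI g hB h0, companionTower_isDatum T S.m (a' * a) _ hI g hB h0,
    companionTower_boundary T S.m (a' * a) _ hI g hB h0⟩
  · rcases hw with h | h <;> omega
  · rcases hw with h | h <;> omega

end CouplingDescent

section CouplingPortTheorem

/-! ## §138a (g40 · NEW) THE PORT `CouplingPort n` IS A THEOREM, for every weight `n` -/

/-- **THE COUPLING PORT HOLDS** (THE MAP): along an in-locus principal impure shadow of an infinite forced tower of weight `n` whose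
factor orders are commensurable, the tail of the tower re-marked by the coupled marking of the two factors is a forced tower over the
same field of a weight `1 ≤ w < n` — VERBATIM `CouplingPort n` (Theorems/CouplingCutClasses §28), all `n`, class-free.
(Sources: Kollar2007, 3.58–3.60, 3.71; BierstoneGrigorievMilmanWlodarczyk2011, §3.1–3.2; EncinasVillamayor2000; CossartJannsenSaito2020, §6.) -/
theorem couplingPort_holds (n : ℕ) : CouplingPort n := by
  intro p _ k _ _ T g hB hD _ _ S hin hP hnp hcomm
  obtain ⟨a, ha0, ha1, han, hF⟩ := S.exists_factorAt_cofactor T g hB hD hin hP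
  have hne : a ≠ n := fun h => hnp ((S.pure_iff_topOrder_zero_eq T g hB hD hin hP).mpr (by rw [← ha0, h]))
  have hlt : a < n := lt_of_le_of_ne han hne
  have hst : S.StableFrom 0 a := fun i _ => S.topOrder_eq_of_factorAt T g hB hD hF hP i
  exact S.couplingDescent T g hB hD hF ha1 (by omega) (hcomm 0 a hst)

/-- **`CouplingPortAll` holds.** [this node] -/
theorem couplingPortAll_holds : CouplingPortAll := fun n _ => couplingPort_holds n

/-- sanity: at weight `1` the port was vacuous (g18 `couplingPort_one_iff`); the theorem specializes consistently. [folklore] -/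
theorem couplingPort_one_holds : CouplingPort 1 := couplingPort_holds 1

end CouplingPortTheorem

end Summit.ResolutionOfSingularities.ResolutionOfSingularities.Theorems.HugValuationCut
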